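import Summits.AtomisticToContinuum.HydrodynamicLimit.Theorems.CollisionIsometryCLTAdaptedWeightCLTSustainedAnisotropy

/-!
# Equilibrium rung of `stub_reynolds` (line `sustained-anisotropy-superexp`, crux stmt-AtomisticToContinuum-14868):
# the cell self-shares vanish in the mean, UNIFORMLY in the configuration (pigeonhole on `𝕋³`)

Support file (`--supports stmt-AtomisticToContinuum-14868`, anchor `stub_reynolds_packing_anchor`) of the stub worker of
`stub_reynolds` (the sub-block Reynolds remainder `ReynInt`, the line's declared exposure). At EQUILIBRIUM (constant
profiles, velocities i.i.d. `N(u, θ𝟙)` given the positions) the conditional mean of the Reynolds factor `reyC` at a block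
is governed by the CELL SELF-SHARES `Σⱼ pᵢⱼ²`, `pᵢⱼ = ψ_N(xⱼ − xᵢ)/Σₖ ψ_N(xₖ − xᵢ)` (the convex weights of the cell velocity
`cvel N ψ w i = Σⱼ pᵢⱼ vⱼ`): `E‖cvelᵢ − ū(x)‖² = 3θ Σⱼ (pᵢⱼ − qⱼ)²`. An `ℓ_N`-isolated particle has `pᵢᵢ = 1` and is
charged its full thermal energy, so the rung seems to need occupation statistics of the hard-sphere Gibbs POSITION
marginal at the mesoscale `ℓ_N` (absent from the tree). It does not: this file proves the DETERMINISTIC bound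

  `(N+1)⁻¹ Σᵢ Σⱼ pᵢⱼ² ≤ R · (K (4/ℓ_N + 3)³ /(N+1) + 1/K)`   for every configuration, every `K ≥ 1`

(`avg_cellShare_sq_le`), `R = R(ψ)`, whence `(N+1)⁻¹ Σᵢ Σⱼ pᵢⱼ² → 0` uniformly in the configuration
(`avg_cellShare_sq_small`, using only `(N+1) ℓ_N³ → ∞` and `ℓ_N → 0` of `CellKernel`). Ingredients:

* `euclidDist_le_of_coarseCell_eq` — two points in the same `r`-cell of `Torus.coarseCell` are within minimal-image
  distance `2r`; `exists_cellIndex` — the cells are indexed by a finite set of size `≤ (1/r + 3)³`;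
* `card_sparse_le` — PIGEONHOLE: the particles whose `(ℓ/2)`-ball holds `≤ K` particles number at most `K (4/ℓ + 3)³`
  (all particles of one `(ℓ/4)`-cell lie in the `(ℓ/2)`-ball of any one of them);
* `avg_inv_occupancy_le` — hence the mean inverse occupancy `(N+1)⁻¹ Σᵢ 1/nᵢ ≤ K (4/ℓ+3)³/(N+1) + 1/K`;
* `exists_cellShare_le` — `pᵢⱼ ≤ R/nᵢ` for a cell kernel (height `≤ Cψ ℓ⁻³`, floor `≥ cψ ℓ⁻³` on the half ball).

No measure appears: this is the position-uniform input of the static Gaussian estimate of `E ∫ₓ ethC · reyC` (files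
`…SAReynoldsStatics/Dynamics`, architecture of the sibling rung `…CBEqRung*`: "no position law of large numbers is used").
-/

namespace Summit.AtomisticToContinuum.HydrodynamicLimit.Theorems.SustainedAnisotropy

open scoped BigOperators Topology Classical MeasureTheory ENNReal InnerProductSpace
open Filter Set MeasureTheory
open Literature.Analysis.FluidPDE
open Summit.AtomisticToContinuum.HydrodynamicLimit.Theorems.ContactSourceDuhamel
open Summit.AtomisticToContinuum.HydrodynamicLimit.Theorems.ContactSourceDuhamel.TimeLocal
open Summit.AtomisticToContinuum.HydrodynamicLimit.Theorems.ContactBalance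
open Literature.MathematicalPhysics.KineticTheory (hsDiameter localGibbsLaw empiricalDensityField
  empiricalMomentumField euclidDist_triangle)

noncomputable section

namespace Reynolds

/-! ## Cells of the torus: same cell ⇒ close; finitely many cells -/

/-- Two points of `𝕋³` in the same `r`-cell of `Torus.coarseCell` (`0 < r`) are within minimal-image distance `2r`
(each symmetric coordinate differs by less than `r`, and the minimal-image norm of the projection of the coordinate
difference is at most its Euclidean norm `≤ √3 r ≤ 2r`). -/
theorem euclidDist_le_of_coarseCell_eq {r : ℝ} (hr : 0 < r) {x y : T3}
    (h : Torus.coarseCell r x = Torus.coarseCell r y) : Torus.euclidDist x y ≤ 2 * r := by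
  have hc : ∀ l, |Torus.reprSym x l - Torus.reprSym y l| ≤ r := by
    intro l
    have he : ⌊Torus.reprSym x l / r⌋ = ⌊Torus.reprSym y l / r⌋ := congr_fun h l
    have hx1 := Int.floor_le (Torus.reprSym x l / r)
    have hx2 := Int.lt_floor_add_one (Torus.reprSym x l / r)
    have hy1 := Int.floor_le (Torus.reprSym y l / r)
    have hy2 := Int.lt_floor_add_one (Torus.reprSym y l / r)
    rw [he] at hx1 hx2
    rw [le_div_iff₀ hr] at hx1 hy1
    rw [div_lt_iff₀ hr] at hx2 hy2
    rw [abs_le]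
    constructor <;> nlinarith
  have hnorm : ‖Torus.reprSym x - Torus.reprSym y‖ ≤ 2 * r := by
    rw [EuclideanSpace.norm_eq]
    have hsum : ∑ l, ‖(Torus.reprSym x - Torus.reprSym y).ofLp l‖ ^ 2 ≤ (2 * r) ^ 2 := by
      calc ∑ l, ‖(Torus.reprSym x - Torus.reprSym y).ofLp l‖ ^ 2 ≤ ∑ _l : Fin 3, r ^ 2 :=
            Finset.sum_le_sum fun l _ => by
              rw [Real.norm_eq_abs, WithLp.ofLp_sub, Pi.sub_apply, sq_abs]
              have := hc l
              rw [abs_le] at this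
              nlinarith [this.1, this.2]
        _ = 3 * r ^ 2 := by simp
        _ ≤ (2 * r) ^ 2 := by nlinarith [hr]
    calc Real.sqrt (∑ l, ‖(Torus.reprSym x - Torus.reprSym y).ofLp l‖ ^ 2) ≤ Real.sqrt ((2 * r) ^ 2) :=
          Real.sqrt_le_sqrt hsum
      _ = 2 * r := Real.sqrt_sq (by positivity)
  have hproj : Literature.Analysis.FunctionSpaces.Torus.proj (Torus.reprSym x - Torus.reprSym y) = x - y := by
    rw [sub_eq_add_neg, Literature.Analysis.FunctionSpaces.Torus.proj_add,
      Literature.Analysis.FunctionSpaces.Torus.proj_neg, Torus.proj_reprSym, Torus.proj_reprSym, ← sub_eq_add_neg]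
  rw [Torus.euclidDist_eq]
  exact (Torus.norm_reprSym_le_of_proj_eq hproj).trans hnorm

/-- The `r`-cells of `𝕋³` (`0 < r`) are indexed by a finite set of at most `(1/r + 3)³` integer vectors (each symmetric
coordinate lies in `(-1/2, 1/2]`, so each cell coordinate lies in `[-m, m]`, `m = ⌈1/(2r)⌉`). -/
theorem exists_cellIndex {r : ℝ} (hr : 0 < r) :
    ∃ E : Finset (Fin 3 → ℤ), (E.card : ℝ) ≤ (1 / r + 3) ^ 3 ∧ ∀ x : T3, Torus.coarseCell r x ∈ E := by
  set m : ℕ := ⌈1 / (2 * r)⌉₊ with hm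
  refine ⟨Fintype.piFinset fun _ : Fin 3 => Finset.Icc (-(m : ℤ)) m, ?_, ?_⟩
  · rw [Fintype.card_piFinset, Finset.prod_const, Finset.card_univ, Fintype.card_fin, Int.card_Icc]
    have hm1 : (m : ℝ) ≤ 1 / (2 * r) + 1 := by
      have := Nat.ceil_lt_add_one (show (0 : ℝ) ≤ 1 / (2 * r) by positivity)
      rw [hm]; linarith
    have htn : ((m : ℤ) + 1 - -(m : ℤ)).toNat = 2 * m + 1 := by omega
    rw [htn]
    push_cast
    have h0 : (0 : ℝ) ≤ 2 * (m : ℝ) + 1 := by positivity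
    calc (2 * (m : ℝ) + 1) ^ 3 ≤ (2 * (1 / (2 * r) + 1) + 1) ^ 3 := by gcongr
      _ = (1 / r + 3) ^ 3 := by congr 1; field_simp; ring
  · intro x
    rw [Fintype.mem_piFinset]
    intro l
    rw [Finset.mem_Icc]
    have hIoc := Torus.reprSym_apply_mem_Ioc x l
    have hmr : 1 / (2 * r) ≤ (m : ℝ) := Nat.le_ceil _
    have hlo : -(m : ℝ) ≤ Torus.reprSym x l / r := by
      rw [le_div_iff₀ hr]
      have : (m : ℝ) * r ≥ 1 / 2 := by
        calc (m : ℝ) * r ≥ 1 / (2 * r) * r := by gcongr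
          _ = 1 / 2 := by field_simp
      linarith [hIoc.1]
    have hhi : Torus.reprSym x l / r ≤ (m : ℝ) := by
      rw [div_le_iff₀ hr]
      have : (m : ℝ) * r ≥ 1 / (2 * r) * r := by gcongr
      have h2 : 1 / (2 * r) * r = 1 / 2 := by field_simp
      linarith [hIoc.2]
    constructor
    · have : (-(m : ℤ) : ℤ) ≤ ⌊Torus.reprSym x l / r⌋ := by
        rw [Int.le_floor]; push_cast; exact hlo
      exact this
    · have : ⌊Torus.reprSym x l / r⌋ ≤ (m : ℤ) := by
        rw [← Int.cast_le (R := ℝ)]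
        exact (Int.floor_le _).trans (by exact_mod_cast hhi)
      exact this

/-! ## Pigeonhole: few particles have sparse neighbourhoods -/

/-- The `(ℓ/2)`-NEIGHBOURHOOD OCCUPANCY of particle `i` is at least one (the particle itself). -/
theorem one_le_occupancy {N : ℕ} (p : Fin (N + 1) → T3) {ℓ : ℝ} (hℓ : 0 < ℓ) (i : Fin (N + 1)) :
    1 ≤ (Finset.univ.filter fun k : Fin (N + 1) => Torus.euclidDist (p k) (p i) ≤ ℓ / 2).card := by
  rw [Nat.one_le_iff_ne_zero, ← Nat.pos_iff_ne_zero, Finset.card_pos]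
  exact ⟨i, Finset.mem_filter.2 ⟨Finset.mem_univ _, by rw [Torus.euclidDist_self]; positivity⟩⟩

/-- PIGEONHOLE. The particles whose `(ℓ/2)`-ball holds at most `K` particles number at most `K (4/ℓ + 3)³`: all the
particles of one `(ℓ/4)`-cell lie in the `(ℓ/2)`-ball of any one of them, so each of the `≤ (4/ℓ + 3)³` cells holds at
most `K` such particles. -/
theorem card_sparse_le {N : ℕ} (p : Fin (N + 1) → T3) {ℓ : ℝ} (hℓ : 0 < ℓ) (K : ℕ) :
    ((Finset.univ.filter fun i : Fin (N + 1) =>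
        (Finset.univ.filter fun k : Fin (N + 1) => Torus.euclidDist (p k) (p i) ≤ ℓ / 2).card ≤ K).card : ℝ) ≤
      K * (4 / ℓ + 3) ^ 3 := by
  obtain ⟨E, hE, hmem⟩ := exists_cellIndex (r := ℓ / 4) (by positivity)
  set S := Finset.univ.filter fun i : Fin (N + 1) =>
    (Finset.univ.filter fun k : Fin (N + 1) => Torus.euclidDist (p k) (p i) ≤ ℓ / 2).card ≤ K with hS
  have h1 : S.card = ∑ e ∈ E, (S.filter fun i => Torus.coarseCell (ℓ / 4) (p i) = e).card :=
    Finset.card_eq_sum_card_fiberwise fun i _ => hmem (p i)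
  have h2 : ∀ e ∈ E, (S.filter fun i => Torus.coarseCell (ℓ / 4) (p i) = e).card ≤ K := by
    intro e _
    rcases (S.filter fun i => Torus.coarseCell (ℓ / 4) (p i) = e).eq_empty_or_nonempty with h0 | ⟨i₀, hi₀⟩
    · simp [h0]
    · rw [Finset.mem_filter] at hi₀
      have hK : (Finset.univ.filter fun k : Fin (N + 1) => Torus.euclidDist (p k) (p i₀) ≤ ℓ / 2).card ≤ K :=
        (Finset.mem_filter.1 hi₀.1).2
      refine le_trans (Finset.card_le_card fun i hi => ?_) hK
      rw [Finset.mem_filter] at hi ⊢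
      refine ⟨Finset.mem_univ _, ?_⟩
      have := euclidDist_le_of_coarseCell_eq (r := ℓ / 4) (by positivity) (hi.2.trans hi₀.2.symm)
      linarith
  have h1e : ((1 / (ℓ / 4) + 3) : ℝ) = 4 / ℓ + 3 := by field_simp
  calc (S.card : ℝ) = ∑ e ∈ E, ((S.filter fun i => Torus.coarseCell (ℓ / 4) (p i) = e).card : ℝ) := by
        rw [h1]; push_cast; rfl
    _ ≤ ∑ _e ∈ E, (K : ℝ) := Finset.sum_le_sum fun e he => by exact_mod_cast h2 e he
    _ = E.card * K := by rw [Finset.sum_const, nsmul_eq_mul]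
    _ ≤ (4 / ℓ + 3) ^ 3 * K := by rw [← h1e]; gcongr
    _ = K * (4 / ℓ + 3) ^ 3 := mul_comm _ _

/-- The MEAN INVERSE OCCUPANCY is small: `(N+1)⁻¹ Σᵢ 1/nᵢ ≤ K (4/ℓ + 3)³/(N+1) + 1/K` for every `K ≥ 1`
(sparse particles contribute `≤ 1` each, the others `≤ 1/K` each). -/
theorem avg_inv_occupancy_le {N : ℕ} (p : Fin (N + 1) → T3) {ℓ : ℝ} (hℓ : 0 < ℓ) {K : ℕ} (hK : 1 ≤ K) :
    ((N + 1 : ℕ) : ℝ)⁻¹ * ∑ i : Fin (N + 1),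
        ((Finset.univ.filter fun k : Fin (N + 1) => Torus.euclidDist (p k) (p i) ≤ ℓ / 2).card : ℝ)⁻¹ ≤
      K * (4 / ℓ + 3) ^ 3 / ((N + 1 : ℕ) : ℝ) + (K : ℝ)⁻¹ := by
  set n : Fin (N + 1) → ℕ := fun i =>
    (Finset.univ.filter fun k : Fin (N + 1) => Torus.euclidDist (p k) (p i) ≤ ℓ / 2).card with hn
  have hM : (0 : ℝ) < ((N + 1 : ℕ) : ℝ) := by positivity
  have hn1 : ∀ i, 1 ≤ n i := fun i => one_le_occupancy p hℓ i
  -- pointwise: 1/nᵢ ≤ 𝟙[nᵢ ≤ K] + 1/K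
  have hpt : ∀ i, ((n i : ℕ) : ℝ)⁻¹ ≤ (if n i ≤ K then (1 : ℝ) else 0) + (K : ℝ)⁻¹ := by
    intro i
    have hni : (1 : ℝ) ≤ n i := by exact_mod_cast hn1 i
    split_ifs with hle
    · have : ((n i : ℕ) : ℝ)⁻¹ ≤ 1 := inv_le_one_of_one_le₀ hni
      linarith [inv_nonneg.2 (show (0 : ℝ) ≤ K by positivity)]
    · have : (K : ℝ) ≤ n i := by exact_mod_cast (not_le.1 hle).le
      rw [zero_add]
      exact inv_anti₀ (by exact_mod_cast hK) this
  have hsum : ∑ i, ((n i : ℕ) : ℝ)⁻¹ ≤ K * (4 / ℓ + 3) ^ 3 + (N + 1 : ℕ) * (K : ℝ)⁻¹ := by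
    calc ∑ i, ((n i : ℕ) : ℝ)⁻¹ ≤ ∑ i, ((if n i ≤ K then (1 : ℝ) else 0) + (K : ℝ)⁻¹) :=
          Finset.sum_le_sum fun i _ => hpt i
      _ = ((Finset.univ.filter fun i => n i ≤ K).card : ℝ) + (N + 1 : ℕ) * (K : ℝ)⁻¹ := by
          rw [Finset.sum_add_distrib, Finset.sum_const, Finset.card_univ, Fintype.card_fin, nsmul_eq_mul,
            Finset.sum_ite, Finset.sum_const_zero, add_zero, Finset.sum_const, nsmul_eq_mul, mul_one]
      _ ≤ K * (4 / ℓ + 3) ^ 3 + (N + 1 : ℕ) * (K : ℝ)⁻¹ := by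
          gcongr
          exact card_sparse_le p hℓ K
  calc ((N + 1 : ℕ) : ℝ)⁻¹ * ∑ i, ((n i : ℕ) : ℝ)⁻¹
      ≤ ((N + 1 : ℕ) : ℝ)⁻¹ * (K * (4 / ℓ + 3) ^ 3 + (N + 1 : ℕ) * (K : ℝ)⁻¹) :=
        mul_le_mul_of_nonneg_left hsum (inv_nonneg.2 hM.le)
    _ = K * (4 / ℓ + 3) ^ 3 / ((N + 1 : ℕ) : ℝ) + (K : ℝ)⁻¹ := by
        field_simp

/-! ## Cell self-shares of a cell kernel -/

/-- The CELL SHARES `pᵢⱼ = ψ_N(xⱼ − xᵢ)/Σₖ ψ_N(xₖ − xᵢ)` of a cell kernel are at most `R/nᵢ`, `nᵢ` the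
`(ℓ_N/2)`-occupancy of particle `i` (height `≤ Cψ ℓ⁻³`; the `nᵢ` particles of the half ball weigh `≥ cψ ℓ⁻³` each). -/
theorem exists_cellShare_le {ψ : ℕ → T3 → ℝ} {ℓ : ℕ → ℝ} (h : CellKernel ψ ℓ) :
    ∃ R : ℝ, 0 ≤ R ∧ ∀ (N : ℕ) (w : Cfg N) (i j : Fin (N + 1)),
      wgtC N ψ w (w i).1 j / (∑ k, wgtC N ψ w (w i).1 k) ≤
        R / (Finset.univ.filter fun k : Fin (N + 1) => Torus.euclidDist (w k).1 (w i).1 ≤ ℓ N / 2).card := by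
  obtain ⟨_, h0, _, hℓ, _, ⟨Cψ, hC⟩, ⟨cψ, hc, hlow⟩, _, _⟩ := h
  have hC0 : 0 ≤ Cψ := by
    have h1 := (h0 0 0).trans (hC 0 0)
    have h2 : 0 < (ℓ 0)⁻¹ ^ 3 := pow_pos (inv_pos.2 (hℓ 0)) 3
    nlinarith
  refine ⟨Cψ / cψ, div_nonneg hC0 hc.le, fun N w i j => ?_⟩
  set B := Finset.univ.filter fun k : Fin (N + 1) => Torus.euclidDist (w k).1 (w i).1 ≤ ℓ N / 2 with hB
  have hl3 : 0 < (ℓ N)⁻¹ ^ 3 := pow_pos (inv_pos.2 (hℓ N)) 3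
  have hBpos : 0 < B.card := Finset.card_pos.2 ⟨i, Finset.mem_filter.2 ⟨Finset.mem_univ _, by
    rw [Torus.euclidDist_self]; linarith [hℓ N]⟩⟩
  -- the denominator dominates `nᵢ · cψ ℓ⁻³`
  have hden : (B.card : ℝ) * (cψ * (ℓ N)⁻¹ ^ 3) ≤ ∑ k, wgtC N ψ w (w i).1 k := by
    calc (B.card : ℝ) * (cψ * (ℓ N)⁻¹ ^ 3) = ∑ _k ∈ B, cψ * (ℓ N)⁻¹ ^ 3 := by
          rw [Finset.sum_const, nsmul_eq_mul]
      _ ≤ ∑ k ∈ B, wgtC N ψ w (w i).1 k := Finset.sum_le_sum fun k hk => by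
          refine hlow N _ ?_
          rw [Torus.euclidDist_eq, sub_zero, ← Torus.euclidDist_eq]
          exact (Finset.mem_filter.1 hk).2
      _ ≤ ∑ k, wgtC N ψ w (w i).1 k :=
          Finset.sum_le_univ_sum_of_nonneg fun k => h0 N _
  have hdenpos : 0 < ∑ k, wgtC N ψ w (w i).1 k :=
    lt_of_lt_of_le (mul_pos (by exact_mod_cast hBpos) (mul_pos hc hl3)) hden
  rw [div_le_div_iff₀ hdenpos (by exact_mod_cast hBpos)]
  calc wgtC N ψ w (w i).1 j * (B.card : ℝ) ≤ Cψ * (ℓ N)⁻¹ ^ 3 * B.card :=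
        mul_le_mul_of_nonneg_right (hC N _) (by positivity)
    _ = Cψ / cψ * ((B.card : ℝ) * (cψ * (ℓ N)⁻¹ ^ 3)) := by field_simp
    _ ≤ Cψ / cψ * ∑ k, wgtC N ψ w (w i).1 k :=
        mul_le_mul_of_nonneg_left hden (div_nonneg hC0 hc.le)

/-- The cell shares are convex weights: nonnegative … -/
theorem cellShare_nonneg {ψ : ℕ → T3 → ℝ} {ℓ : ℕ → ℝ} (h : CellKernel ψ ℓ) (N : ℕ) (w : Cfg N) (i j : Fin (N + 1)) :
    0 ≤ wgtC N ψ w (w i).1 j / ∑ k, wgtC N ψ w (w i).1 k :=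
  div_nonneg (h.2.1 N _) (Finset.sum_nonneg fun _ _ => h.2.1 N _)

/-- … and summing to one (the cell of a particle contains the particle: `ψ_N(0) > 0`). -/
theorem sum_cellShare_eq_one {ψ : ℕ → T3 → ℝ} {ℓ : ℕ → ℝ} (h : CellKernel ψ ℓ) (N : ℕ) (w : Cfg N)
    (i : Fin (N + 1)) : ∑ j, wgtC N ψ w (w i).1 j / ∑ k, wgtC N ψ w (w i).1 k = 1 := by
  have hpos : 0 < ∑ k, wgtC N ψ w (w i).1 k := by
    obtain ⟨-, h0, -, hℓ, -, -, ⟨cψ, hc, hlow⟩, -, -⟩ := h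
    refine Finset.sum_pos' (fun k _ => h0 N _) ⟨i, Finset.mem_univ _, ?_⟩
    have h1 : cψ * (ℓ N)⁻¹ ^ 3 ≤ ψ N 0 := hlow N 0 (by rw [Torus.euclidDist_self]; linarith [hℓ N])
    have h2 : 0 < cψ * (ℓ N)⁻¹ ^ 3 := mul_pos hc (pow_pos (inv_pos.2 (hℓ N)) 3)
    simpa [wgtC] using h2.trans_le h1
  rw [← Finset.sum_div, div_self hpos.ne']

/-- MAIN DETERMINISTIC BOUND. For a cell kernel there is `R ≥ 0` such that for every `N`, every configuration and
every `K ≥ 1`: `(N+1)⁻¹ Σᵢ Σⱼ pᵢⱼ² ≤ R (K (4/ℓ_N + 3)³/(N+1) + 1/K)` (`Σⱼ pᵢⱼ² ≤ maxⱼ pᵢⱼ ≤ R/nᵢ`, then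
`avg_inv_occupancy_le`). -/
theorem avg_cellShare_sq_le {ψ : ℕ → T3 → ℝ} {ℓ : ℕ → ℝ} (h : CellKernel ψ ℓ) :
    ∃ R : ℝ, 0 ≤ R ∧ ∀ (N : ℕ) (w : Cfg N) (K : ℕ), 1 ≤ K →
      ((N + 1 : ℕ) : ℝ)⁻¹ * ∑ i : Fin (N + 1), ∑ j : Fin (N + 1),
          (wgtC N ψ w (w i).1 j / ∑ k, wgtC N ψ w (w i).1 k) ^ 2 ≤
        R * (K * (4 / ℓ N + 3) ^ 3 / ((N + 1 : ℕ) : ℝ) + (K : ℝ)⁻¹) := by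
  obtain ⟨R, hR, hshare⟩ := exists_cellShare_le h
  refine ⟨R, hR, fun N w K hK => ?_⟩
  have hℓ : 0 < ℓ N := h.2.2.2.1 N
  set n : Fin (N + 1) → ℕ := fun i =>
    (Finset.univ.filter fun k : Fin (N + 1) => Torus.euclidDist (w k).1 (w i).1 ≤ ℓ N / 2).card with hn
  -- per particle: Σⱼ pᵢⱼ² ≤ R / nᵢ
  have hpt : ∀ i, ∑ j, (wgtC N ψ w (w i).1 j / ∑ k, wgtC N ψ w (w i).1 k) ^ 2 ≤ R * ((n i : ℕ) : ℝ)⁻¹ := by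
    intro i
    calc ∑ j, (wgtC N ψ w (w i).1 j / ∑ k, wgtC N ψ w (w i).1 k) ^ 2
        ≤ ∑ j, (wgtC N ψ w (w i).1 j / ∑ k, wgtC N ψ w (w i).1 k) * (R / n i) :=
          Finset.sum_le_sum fun j _ => by
            rw [sq]
            exact mul_le_mul_of_nonneg_left (hshare N w i j) (cellShare_nonneg h N w i j)
      _ = R * ((n i : ℕ) : ℝ)⁻¹ := by
          rw [← Finset.sum_mul, sum_cellShare_eq_one h N w i, one_mul, div_eq_mul_inv]
  have hM : (0 : ℝ) ≤ ((N + 1 : ℕ) : ℝ)⁻¹ := by positivity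
  calc ((N + 1 : ℕ) : ℝ)⁻¹ * ∑ i, ∑ j, (wgtC N ψ w (w i).1 j / ∑ k, wgtC N ψ w (w i).1 k) ^ 2
      ≤ ((N + 1 : ℕ) : ℝ)⁻¹ * ∑ i, R * ((n i : ℕ) : ℝ)⁻¹ :=
        mul_le_mul_of_nonneg_left (Finset.sum_le_sum fun i _ => hpt i) hM
    _ = R * (((N + 1 : ℕ) : ℝ)⁻¹ * ∑ i, ((n i : ℕ) : ℝ)⁻¹) := by rw [← Finset.mul_sum]; ring
    _ ≤ R * (K * (4 / ℓ N + 3) ^ 3 / ((N + 1 : ℕ) : ℝ) + (K : ℝ)⁻¹) :=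
        mul_le_mul_of_nonneg_left (avg_inv_occupancy_le (fun k => (w k).1) hℓ hK) hR

end Reynolds

/-! ## The registered anchor: the mean cell self-share vanishes uniformly in the configuration -/

open Reynolds in
/-- ANCHOR (`stub_reynolds_packing_anchor`). For a cell kernel family, the configuration-uniform mean of the squared
cell shares tends to zero: for every `ε > 0`, eventually in `N`, for EVERY configuration `w`,
`(N+1)⁻¹ Σᵢ Σⱼ pᵢⱼ² ≤ ε` (choose `K ≈ 2R/ε` in `avg_cellShare_sq_le`, then `(4/ℓ_N + 3)³/(N+1) ≤ 343/((N+1)ℓ_N³) → 0`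
by `ℓ_N → 0` and `(N+1) ℓ_N³ → ∞`). This is why the equilibrium value of the Reynolds factor (`≍ θ Σⱼ pᵢⱼ²` per
particle) needs no occupation statistics of the Gibbs position marginal. -/
theorem stub_reynolds_packing_anchor : ∀ (ψ : ℕ → T3 → ℝ) (ℓ : ℕ → ℝ), CellKernel ψ ℓ → ∀ ε : ℝ, 0 < ε →
    ∃ N₀ : ℕ, ∀ N : ℕ, N₀ ≤ N → ∀ w : Cfg N,
      ((N + 1 : ℕ) : ℝ)⁻¹ * ∑ i : Fin (N + 1), ∑ j : Fin (N + 1),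
          (wgtC N ψ w (w i).1 j / ∑ k, wgtC N ψ w (w i).1 k) ^ 2 ≤ ε := by
  intro ψ ℓ h ε hε
  obtain ⟨R, hR, hmain⟩ := avg_cellShare_sq_le h
  have hℓ : ∀ N, 0 < ℓ N := h.2.2.2.1
  -- the occupancy scale and the two limits of `CellKernel`
  have hℓ0 : Tendsto ℓ atTop (𝓝 0) := by
    have h6 := h.2.2.2.2.2.2.2.1
    have hge : ∀ N : ℕ, (1 : ℝ) ≤ ((N + 1 : ℕ) : ℝ) ^ ((1 : ℝ) / 6) := fun N =>
      Real.one_le_rpow (by exact_mod_cast Nat.succ_le_succ (Nat.zero_le N)) (by positivity)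
    refine squeeze_zero (fun N => (hℓ N).le) (fun N => ?_) h6
    simpa using mul_le_mul_of_nonneg_left (hge N) (hℓ N).le
  have hvol := h.2.2.2.2.2.2.2.2
  -- choose K with R/K ≤ ε/2
  obtain ⟨K, hK⟩ := exists_nat_gt (2 * R / ε)
  have hK1 : 1 ≤ K + 1 := Nat.le_add_left 1 K
  have hKpos : (0 : ℝ) < (K + 1 : ℕ) := by positivity
  have hRK : R * ((K + 1 : ℕ) : ℝ)⁻¹ ≤ ε / 2 := by
    rw [← div_eq_mul_inv, div_le_iff₀ hKpos]
    have : (2 * R / ε) * ε = 2 * R := by field_simp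
    have hK' : 2 * R / ε < (K + 1 : ℕ) := by push_cast; linarith
    nlinarith [hK'.le, hε.le]
  -- eventually `ℓ_N ≤ 1` and `R (K+1) 343 / ((N+1) ℓ_N³) ≤ ε/2`
  have hev1 : ∀ᶠ N : ℕ in atTop, ℓ N ≤ 1 := (hℓ0.eventually (ge_mem_nhds one_pos)).mono fun N hN => hN
  have hev2 : ∀ᶠ N : ℕ in atTop, R * ((K + 1 : ℕ) : ℝ) * 343 * (2 / ε + 1) ≤ ((N + 1 : ℕ) : ℝ) * ℓ N ^ 3 :=
    (hvol.eventually (eventually_ge_atTop _)).mono fun N hN => hN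
  obtain ⟨N₀, hN₀⟩ := (hev1.and hev2).exists_forall_of_atTop
  refine ⟨N₀, fun N hN w => ?_⟩
  obtain ⟨hl1, hl2⟩ := hN₀ N hN
  have hM : (0 : ℝ) < ((N + 1 : ℕ) : ℝ) := by positivity
  have hl3 : 0 < ℓ N ^ 3 := pow_pos (hℓ N) 3
  -- `(4/ℓ + 3)³ ≤ 343/ℓ³` for `ℓ ≤ 1`
  have hcube : (4 / ℓ N + 3) ^ 3 ≤ 343 / ℓ N ^ 3 := by
    have h7 : 4 / ℓ N + 3 ≤ 7 / ℓ N := by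
      rw [div_add' _ _ _ (hℓ N).ne', div_le_div_iff_of_pos_right (hℓ N)]
      linarith
    have h47 : 0 ≤ 4 / ℓ N + 3 := by have := hℓ N; positivity
    calc (4 / ℓ N + 3) ^ 3 ≤ (7 / ℓ N) ^ 3 := pow_le_pow_left₀ h47 h7 3
      _ = 343 / ℓ N ^ 3 := by rw [div_pow]; norm_num
  -- the sparse term: `R (K+1) (4/ℓ+3)³/(N+1) ≤ R (K+1) 343/((N+1) ℓ³) ≤ ε/2`
  set A : ℝ := R * ((K + 1 : ℕ) : ℝ) * 343 with hA
  have hA0 : 0 ≤ A := by positivity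
  have hAle : A ≤ ε / 2 * (((N + 1 : ℕ) : ℝ) * ℓ N ^ 3) := by
    have h1 : A * (2 / ε) ≤ ((N + 1 : ℕ) : ℝ) * ℓ N ^ 3 := by
      have h2 : A * (2 / ε) ≤ A * (2 / ε + 1) := by nlinarith
      exact h2.trans hl2
    have h3 : A ≤ ((N + 1 : ℕ) : ℝ) * ℓ N ^ 3 / (2 / ε) := (le_div_iff₀ (by positivity)).2 h1
    calc A ≤ ((N + 1 : ℕ) : ℝ) * ℓ N ^ 3 / (2 / ε) := h3
      _ = ε / 2 * (((N + 1 : ℕ) : ℝ) * ℓ N ^ 3) := by field_simp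
  have hfirst : R * (((K + 1 : ℕ) : ℝ) * (4 / ℓ N + 3) ^ 3 / ((N + 1 : ℕ) : ℝ)) ≤ ε / 2 := by
    calc R * (((K + 1 : ℕ) : ℝ) * (4 / ℓ N + 3) ^ 3 / ((N + 1 : ℕ) : ℝ))
        ≤ R * (((K + 1 : ℕ) : ℝ) * (343 / ℓ N ^ 3) / ((N + 1 : ℕ) : ℝ)) := by gcongr
      _ = A / (((N + 1 : ℕ) : ℝ) * ℓ N ^ 3) := by rw [hA]; field_simp
      _ ≤ ε / 2 := by rw [div_le_iff₀ (mul_pos hM hl3)]; exact hAle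
  calc ((N + 1 : ℕ) : ℝ)⁻¹ * ∑ i, ∑ j, (wgtC N ψ w (w i).1 j / ∑ k, wgtC N ψ w (w i).1 k) ^ 2
      ≤ R * (((K + 1 : ℕ) : ℝ) * (4 / ℓ N + 3) ^ 3 / ((N + 1 : ℕ) : ℝ) + ((K + 1 : ℕ) : ℝ)⁻¹) :=
        hmain N w (K + 1) hK1
    _ = R * (((K + 1 : ℕ) : ℝ) * (4 / ℓ N + 3) ^ 3 / ((N + 1 : ℕ) : ℝ)) + R * ((K + 1 : ℕ) : ℝ)⁻¹ := by ring
    _ ≤ ε / 2 + ε / 2 := add_le_add hfirst hRK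
    _ = ε := by ring

end

end Summit.AtomisticToContinuum.HydrodynamicLimit.Theorems.SustainedAnisotropy
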